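import Mathlib
import Literature.AlgebraicGeometry.Resolution.KummerNormalForm
import Literature.AlgebraicGeometry.Resolution.NormalizationOfVarietiesProofs
import Summits.ResolutionOfSingularities.ResolutionOfSingularities.Theorems.PicoverLocalModel.Negative.PowerDichotomy
import Summits.ResolutionOfSingularities.ResolutionOfSingularities.Theorems.PAlterationPicoverLocalModelDvrDichotomy
import Summits.ResolutionOfSingularities.ResolutionOfSingularities.Theorems.PAlterationPicoverLocalModelBadLocusFinite

/-!
# Crux `PicoverLocalModel` (stmt-ResolutionOfSingularities-0557), line `SketchIdeator3`
# (giraud-cossart-normal-form) — stub `stub_boundaryPointNormalForm`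

For `R` a regular finitely generated `k`-domain of Krull dimension `≤ 1` (`char k = p`),
`a ∈ R ∖ R^p`, a non-zero prime `q` of `R` (so `O = R_q` is a DVR) and a uniformizer `ϖ` of `O`
declared as the (single) boundary equation at `q`, the image `a'` of `a` in `O` is in Giraud
normal form with respect to `![ϖ]`.

Proof. (1) `a'` is `ϖ`-adically separated from the `p`-th powers: `∃ N, ∀ b, ¬ ϖ^N ∣ a' - b^p`.
Indeed let `K = Frac R`, `L = K[T]/(T^p - a) ∋ α` (a field, `T^p - a` being irreducible since `a`
is not a `p`-th power in `K`, `R` normal), `R'` the integral closure of `R` in `L` — a finite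
`R`-module by E. Noether (`NoetherFiniteIntegralClosure_holds`) — and `s₀ ∈ R ∖ 0` an element
multiplying `R'` into `R[α]` (`BadLocusFinite.exists_smul_mem_adjoin_root_of_fg`). Write
`s₀ = u ϖ^n` in `O` and take `N = p (n + 1)`. If `ϖ^N ∣ a' - b^p`, clearing denominators gives
`t₂ (t₁^p a - c₀^p) = t₁^p (ϖ₀^{n+1})^p e₀` in `R` (`ϖ₀ ∈ R` a uniformizer, `t₁, t₂ ∉ q`); then
`γ = t₂ (t₁ α - c₀) / ϖ₀^{n+1}` has `γ^p = t₂^{p-1} t₁^p e₀ ∈ R`, so `γ ∈ R'`, `s₀ γ ∈ R[α]`, and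
its `α`-coordinate `s₀ t₂ t₁ / ϖ₀^{n+1}` lies in `R`: `ϖ^{n+1} ∣ s₀` in `O`, absurd.
(2) By the DVR dichotomy (`DvrDichotomy.exists_sub_pow_eq_mul_unit_dichotomy`),
`a' - b^p = ϖ^m u` with `u` a unit and either `p ∤ m` — the Kummer/toric exit
`a' = b^p + u ϖ^m` — or `p ∣ m = p B₀` and `∀ c, ¬ ϖ ∣ u - c^p` — the wound exit
`a' = b^p + (ϖ^{B₀})^p u`.
-/

noncomputable section

set_option linter.dupNamespace false

open CategoryTheory AlgebraicGeometry Polynomial Literature.AlgebraicGeometry.Resolution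

namespace Summit.ResolutionOfSingularities.ResolutionOfSingularities.Theorems.PicoverLocalModel.BoundaryPointNormalForm

/-! ## Clearing denominators at `q` -/

/-- Clearing denominators at a prime `q`: if `ϖ^n ∣ a - b^p` in `R_q` (`ϖ, a ∈ R`, `b ∈ R_q`),
then `t₂ (t₁^p a - c₀^p) = t₁^p ϖ^n e₀` in `R` for some `c₀ e₀ ∈ R` and `t₁, t₂ ∉ q`.
[folklore] -/
theorem exists_eq_of_pow_dvd_sub_pow {R : Type*} [CommRing R] [IsDomain R] (q : Ideal R)
    [q.IsPrime] (p n : ℕ) (a ϖ : R) {b : Localization.AtPrime q}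
    (h : algebraMap R (Localization.AtPrime q) ϖ ^ n ∣
      algebraMap R (Localization.AtPrime q) a - b ^ p) :
    ∃ c₀ e₀ t₁ t₂ : R, t₁ ∉ q ∧ t₂ ∉ q ∧
      t₂ * (t₁ ^ p * a - c₀ ^ p) = t₁ ^ p * ϖ ^ n * e₀ := by
  obtain ⟨e, he⟩ := h
  obtain ⟨c₀, t₁, hc⟩ : ∃ (c₀ : R) (t₁ : q.primeCompl),
      b * algebraMap R _ t₁ = algebraMap R _ c₀ :=
    let ⟨x, hx⟩ := IsLocalization.surj q.primeCompl b; ⟨x.1, x.2, hx⟩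
  obtain ⟨e₀, t₂, he₀⟩ : ∃ (e₀ : R) (t₂ : q.primeCompl),
      e * algebraMap R _ t₂ = algebraMap R _ e₀ :=
    let ⟨x, hx⟩ := IsLocalization.surj q.primeCompl e; ⟨x.1, x.2, hx⟩
  refine ⟨c₀, e₀, t₁, t₂, t₁.2, t₂.2, ?_⟩
  apply IsLocalization.injective (Localization.AtPrime q) q.primeCompl_le_nonZeroDivisors
  simp only [map_mul, map_sub, map_pow]
  rw [← hc, ← he₀]
  linear_combination (algebraMap R (Localization.AtPrime q) (t₁ : R)) ^ p *
    algebraMap R (Localization.AtPrime q) (t₂ : R) * he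

/-! ## The conductor bound in `L = Frac(R)[T]/(T^p - a)` -/

section Order

variable {R K : Type*} [CommRing R] [IsDomain R] [Field K] [Algebra R K] [IsFractionRing R K]

omit [IsDomain R] in
/-- **The key local computation.** Let `f = T^p - a` over `K = Frac R` be irreducible,
`α = root f`, and `s₀ ∈ R` multiply the integral closure of `R` in `L = K[T]/(f)` into `R[α]`.
If `t₂ (t₁^p a - c₀^p) = t₁^p d^p e₀` in `R` with `d ≠ 0`, then `d ∣ s₀ t₂ t₁`: the element
`γ = t₂ (t₁ α - c₀) / d` satisfies `γ^p = t₂^{p-1} t₁^p e₀ ∈ R`, so `s₀ γ ∈ R[α]` has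
`α`-coordinate `s₀ t₂ t₁ / d ∈ R`. [folklore] -/
theorem dvd_of_conductor (p : ℕ) [Fact p.Prime] [CharP K p] {a : R} {f : K[X]}
    (hf : f = X ^ p - C (algebraMap R K a)) [Fact (Irreducible f)] {s₀ : R}
    (hs₀ : ∀ y ∈ integralClosure R (AdjoinRoot f), s₀ • y ∈ Algebra.adjoin R {AdjoinRoot.root f})
    {d : R} (hd0 : d ≠ 0) {c₀ e₀ t₁ t₂ : R}
    (heq : t₂ * (t₁ ^ p * a - c₀ ^ p) = t₁ ^ p * d ^ p * e₀) :
    d ∣ s₀ * t₂ * t₁ := by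
  have hp : p.Prime := Fact.out
  obtain ⟨n, rfl⟩ : ∃ n, p = n + 2 := ⟨p - 2, by have := hp.two_le; omega⟩
  have hfm : f.Monic := hf ▸ monic_X_pow_sub_C _ (by omega)
  have hfdeg : f.natDegree = n + 2 := by rw [hf, natDegree_X_pow_sub_C]
  have hf0 : (X ^ (n + 2) - C a : R[X]).map (algebraMap R K) = f := by
    rw [hf, Polynomial.map_sub, Polynomial.map_pow, map_X, map_C]
  haveI : CharP (AdjoinRoot f) (n + 2) :=
    charP_of_injective_algebraMap (algebraMap K (AdjoinRoot f)).injective _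
  have hRK : Function.Injective (algebraMap R K) := IsFractionRing.injective R K
  have hRL : Function.Injective (algebraMap R (AdjoinRoot f)) := by
    rw [IsScalarTower.algebraMap_eq R K (AdjoinRoot f), RingHom.coe_comp]
    exact (algebraMap K (AdjoinRoot f)).injective.comp hRK
  -- `α^p = a`
  have hαp : AdjoinRoot.root f ^ (n + 2) = algebraMap R (AdjoinRoot f) a := by
    have h : AdjoinRoot.mk f (X ^ (n + 2) - C (algebraMap R K a)) = 0 := by
      rw [← hf]; exact AdjoinRoot.mk_self
    rw [map_sub, map_pow, AdjoinRoot.mk_X, AdjoinRoot.mk_C, sub_eq_zero] at h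
    rw [h, AdjoinRoot.algebraMap_eq', RingHom.comp_apply]
  -- `β = t₁ α - c₀` and its (linear) representative `g₁`
  obtain ⟨β, hβ⟩ : ∃ β : AdjoinRoot f,
      β = algebraMap R _ t₁ * AdjoinRoot.root f - algebraMap R _ c₀ := ⟨_, rfl⟩
  obtain ⟨g₁, hg₁⟩ : ∃ g₁ : K[X],
      g₁ = C (algebraMap R K t₁) * X + C (-(algebraMap R K c₀)) := ⟨_, rfl⟩
  have hβg₁ : β = AdjoinRoot.mk f g₁ := by
    simp only [hβ, hg₁, map_add, map_mul, map_neg, AdjoinRoot.mk_X, AdjoinRoot.mk_C,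
      AdjoinRoot.algebraMap_eq', RingHom.comp_apply, sub_eq_add_neg]
  have hβp : β ^ (n + 2) = algebraMap R (AdjoinRoot f) (t₁ ^ (n + 2) * a - c₀ ^ (n + 2)) := by
    rw [hβ, sub_pow_char, mul_pow, hαp, map_sub, map_mul, map_pow, map_pow]
  have hrel : algebraMap R (AdjoinRoot f) t₂ * β ^ (n + 2) =
      algebraMap R _ t₁ ^ (n + 2) * algebraMap R _ d ^ (n + 2) * algebraMap R _ e₀ := by
    rw [hβp, ← map_mul, heq, map_mul, map_mul, map_pow, map_pow]
  -- `γ = t₂ β / d` and `γ^p ∈ R`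
  have hD : algebraMap R (AdjoinRoot f) d ≠ 0 := (map_ne_zero_iff _ hRL).mpr hd0
  obtain ⟨γ, hγ⟩ : ∃ γ : AdjoinRoot f,
      γ = algebraMap R _ t₂ * β * (algebraMap R _ d)⁻¹ := ⟨_, rfl⟩
  have hγp : γ ^ (n + 2) = algebraMap R _ (t₂ ^ (n + 1) * (t₁ ^ (n + 2) * e₀)) := by
    have hDp : algebraMap R (AdjoinRoot f) d ^ (n + 2) ≠ 0 := pow_ne_zero _ hD
    rw [← mul_left_inj' hDp]
    calc γ ^ (n + 2) * algebraMap R (AdjoinRoot f) d ^ (n + 2)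
        = algebraMap R _ t₂ ^ (n + 1) * (algebraMap R (AdjoinRoot f) t₂ * β ^ (n + 2)) *
            ((algebraMap R _ d)⁻¹ * algebraMap R (AdjoinRoot f) d) ^ (n + 2) := by
          rw [hγ]; ring
      _ = algebraMap R _ t₂ ^ (n + 1) * (algebraMap R (AdjoinRoot f) t₂ * β ^ (n + 2)) := by
          rw [inv_mul_cancel₀ hD, one_pow, mul_one]
      _ = algebraMap R _ (t₂ ^ (n + 1) * (t₁ ^ (n + 2) * e₀)) *
            algebraMap R (AdjoinRoot f) d ^ (n + 2) := by
          rw [hrel]; simp only [map_mul, map_pow]; ring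
  have hγint : γ ∈ integralClosure R (AdjoinRoot f) := by
    refine ⟨X ^ (n + 2) - C (t₂ ^ (n + 1) * (t₁ ^ (n + 2) * e₀)),
      monic_X_pow_sub_C _ (by omega), ?_⟩
    simp only [eval₂_sub, eval₂_X_pow, eval₂_C, hγp, sub_self]
  have hmem := hs₀ γ hγint
  -- `s₀ γ = κ β` with `κ = s₀ t₂ / d ∈ K`
  obtain ⟨κ, hκ⟩ : ∃ κ : K,
      κ = algebraMap R K s₀ * algebraMap R K t₂ * (algebraMap R K d)⁻¹ := ⟨_, rfl⟩
  have hsγ : s₀ • γ = κ • β := by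
    rw [Algebra.smul_def, Algebra.smul_def, hγ, hκ, map_mul, map_mul, map_inv₀,
      ← IsScalarTower.algebraMap_apply, ← IsScalarTower.algebraMap_apply,
      ← IsScalarTower.algebraMap_apply]
    ring
  -- the `α`-coordinate of `β` is `t₁`
  have hg₁deg : g₁.natDegree ≤ 1 := hg₁ ▸ natDegree_linear_le
  have hdeg : g₁.degree < f.degree := by
    apply degree_lt_degree
    rw [hfdeg]
    omega
  have hcoeff : g₁.coeff 1 = algebraMap R K t₁ := by
    rw [hg₁]
    simp
  have hmod : AdjoinRoot.modByMonicHom hfm (s₀ • γ) = κ • g₁ := by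
    rw [hsγ, LinearMap.map_smul, hβg₁, AdjoinRoot.modByMonicHom_mk,
      (modByMonic_eq_self_iff hfm).mpr hdeg]
  obtain ⟨r, hr⟩ := BadLocusFinite.coeff_modByMonicHom_mem_range (X ^ (n + 2) - C a)
    (monic_X_pow_sub_C _ (by omega)) hf0 hfm hmem 1
  rw [hmod, coeff_smul, hcoeff, smul_eq_mul, hκ] at hr
  -- hence `r d = s₀ t₂ t₁` in `R`
  have hdK : algebraMap R K d ≠ 0 := (map_ne_zero_iff _ hRK).mpr hd0
  refine ⟨r, hRK ?_⟩
  simp only [map_mul]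
  rw [hr]
  field_simp

end Order

/-! ## `a` is `ϖ`-adically separated from the `p`-th powers at a closed point -/

/-- For `R` a regular finitely generated `k`-domain of dimension `≤ 1` (`char k = p`),
`a ∈ R ∖ R^p`, `q ≠ ⊥` a prime and `ϖ` a uniformizer of the DVR `R_q`: there is `N` with
`ϖ^N ∤ a - b^p` in `R_q` for every `b ∈ R_q` (i.e. `a` is not a `p`-th power in the `𝔪_q`-adic
completion). With `s₀ = u ϖ^n ≠ 0` a conductor element of `R[a^{1/p}]` in its (finite, by
E. Noether) normalisation, `N = p (n + 1)` works (`dvd_of_conductor`). [folklore] -/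
theorem exists_forall_not_pow_dvd (p : ℕ) (hp : p.Prime) (k : Type) [Field k] [CharP k p]
    (R : Type) [CommRing R] [IsDomain R] [Algebra k R] [Algebra.FiniteType k R]
    [IsRegularRing R] (hdim : ringKrullDim R ≤ 1) {a : R} (ha : ∀ b : R, b ^ p ≠ a)
    (q : PrimeSpectrum R) (hq : q.asIdeal ≠ ⊥) (ϖ : Localization.AtPrime q.asIdeal)
    (hϖ : IsLocalRing.maximalIdeal (Localization.AtPrime q.asIdeal) = Ideal.span {ϖ}) :
    ∃ N : ℕ, ∀ b : Localization.AtPrime q.asIdeal,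
      ¬ ϖ ^ N ∣ algebraMap R (Localization.AtPrime q.asIdeal) a - b ^ p := by
  haveI : Fact p.Prime := ⟨hp⟩
  haveI : IsIntegrallyClosed R := Negative.isIntegrallyClosed_of_isRegularRing R
  haveI : Ring.DimensionLEOne R := Ring.DimensionLEOne.of_ringKrullDim_le_one hdim
  haveI : IsDedekindRing R := {}
  haveI : IsDiscreteValuationRing (Localization.AtPrime q.asIdeal) :=
    IsLocalization.AtPrime.isDiscreteValuationRing_of_dedekind_domain R hq _
  have hϖirr : Irreducible ϖ := (IsDiscreteValuationRing.irreducible_iff_uniformizer ϖ).mpr hϖ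
  have hRO : Function.Injective (algebraMap R (Localization.AtPrime q.asIdeal)) :=
    IsLocalization.injective (Localization.AtPrime q.asIdeal)
      q.asIdeal.primeCompl_le_nonZeroDivisors
  have haK : ∀ c : FractionRing R, c ^ p ≠ algebraMap R (FractionRing R) a :=
    Negative.not_pow_fractionRing p R ha
  have hRK : Function.Injective (algebraMap R (FractionRing R)) := IsFractionRing.injective R _
  -- the field `L = Frac(R)[T]/(T^p - a)` and the conductor element `s₀`
  obtain ⟨f, hf⟩ : ∃ f : (FractionRing R)[X], f = X ^ p - C (algebraMap R _ a) := ⟨_, rfl⟩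
  have hirr : Irreducible f := hf ▸ X_pow_sub_C_irreducible_of_prime hp haK
  haveI : Fact (Irreducible f) := ⟨hirr⟩
  haveI : Module.Finite (FractionRing R) (AdjoinRoot f) :=
    (AdjoinRoot.powerBasis hirr.ne_zero).finite
  haveI : CharP R p := charP_of_injective_algebraMap (algebraMap k R).injective p
  haveI : CharP (FractionRing R) p := charP_of_injective_algebraMap hRK p
  have hfin : Module.Finite R (integralClosure R (AdjoinRoot f)) :=
    NoetherFiniteIntegralClosure_holds k R (FractionRing R) (AdjoinRoot f)
  have hfg : (Subalgebra.toSubmodule (integralClosure R (AdjoinRoot f))).FG := by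
    rw [← Module.Finite.iff_fg]; exact hfin
  obtain ⟨s₀, hs₀0, hs₀⟩ := BadLocusFinite.exists_smul_mem_adjoin_root_of_fg f hfg
  -- a uniformizer `ϖ₀` coming from `R`
  obtain ⟨ϖ₀, t, hϖt⟩ : ∃ (ϖ₀ : R) (t : q.asIdeal.primeCompl),
      ϖ * algebraMap R _ t = algebraMap R _ ϖ₀ :=
    let ⟨x, hx⟩ := IsLocalization.surj q.asIdeal.primeCompl ϖ; ⟨x.1, x.2, hx⟩
  have htu : IsUnit (algebraMap R (Localization.AtPrime q.asIdeal) t) :=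
    IsLocalization.map_units _ t
  have hϖ₀0 : ϖ₀ ≠ 0 := by
    rintro rfl
    rw [map_zero, htu.mul_left_eq_zero] at hϖt
    exact hϖirr.ne_zero hϖt
  -- the `ϖ`-adic order `n` of `s₀`; `N = p (n + 1)` works
  obtain ⟨n, u, hsu⟩ := IsDiscreteValuationRing.eq_unit_mul_pow_irreducible
    ((map_ne_zero_iff _ hRO).mpr hs₀0) hϖirr
  refine ⟨p * (n + 1), fun b hb => ?_⟩
  have hb' : algebraMap R (Localization.AtPrime q.asIdeal) ϖ₀ ^ (p * (n + 1)) ∣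
      algebraMap R (Localization.AtPrime q.asIdeal) a - b ^ p := by
    rw [← hϖt, mul_pow]
    exact (htu.pow _).mul_right_dvd.mpr hb
  obtain ⟨c₀, e₀, t₁, t₂, ht₁, ht₂, heq⟩ := exists_eq_of_pow_dvd_sub_pow q.asIdeal p _ a ϖ₀ hb'
  rw [pow_mul'] at heq
  have hdvd : ϖ₀ ^ (n + 1) ∣ s₀ * t₂ * t₁ := dvd_of_conductor p hf hs₀ (pow_ne_zero _ hϖ₀0) heq
  -- read in `R_q`: `ϖ^{n+1} ∣ s₀ = u ϖ^n`
  have h1 : ϖ ^ (n + 1) ∣ algebraMap R (Localization.AtPrime q.asIdeal) s₀ := by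
    have h2 : algebraMap R (Localization.AtPrime q.asIdeal) ϖ₀ ^ (n + 1) ∣
        algebraMap R _ s₀ * algebraMap R _ t₂ * algebraMap R _ t₁ := by
      rw [← map_pow, ← map_mul, ← map_mul]
      exact map_dvd _ hdvd
    have h3 : ϖ ^ (n + 1) ∣ algebraMap R (Localization.AtPrime q.asIdeal) ϖ₀ ^ (n + 1) := by
      rw [← hϖt, mul_pow]
      exact dvd_mul_right _ _
    have ht₁u : IsUnit (algebraMap R (Localization.AtPrime q.asIdeal) t₁) :=
      IsLocalization.map_units (M := q.asIdeal.primeCompl) _ ⟨t₁, ht₁⟩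
    have ht₂u : IsUnit (algebraMap R (Localization.AtPrime q.asIdeal) t₂) :=
      IsLocalization.map_units (M := q.asIdeal.primeCompl) _ ⟨t₂, ht₂⟩
    exact ht₂u.dvd_mul_right.mp (ht₁u.dvd_mul_right.mp (h3.trans h2))
  rw [hsu, Units.dvd_mul_left] at h1
  have h5 := (pow_dvd_pow_iff hϖirr.ne_zero hϖirr.not_isUnit).mp h1
  omega

/-! ## The stub -/

/-- STUB (`n ≤ 1`, B) of the line `SketchIdeator3` of crux stmt-ResolutionOfSingularities-0557 —
**Giraud normal form at a declared boundary point of a regular curve**: for `R` a regular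
finitely generated `k`-domain of dimension `≤ 1` (`char k = p`), `a ∈ R ∖ R^p`, a non-zero prime
`q` and a uniformizer `ϖ` of the DVR `R_q` taken as the boundary equation, the image `a'` of `a`
in `R_q` is in Giraud normal form with respect to `![ϖ]`. Since `a'` is `ϖ`-adically separated
from the `p`-th powers (`exists_forall_not_pow_dvd`), the DVR dichotomy
(`DvrDichotomy.exists_sub_pow_eq_mul_unit_dichotomy`) writes `a' - b^p = ϖ^m u`, `u` a unit,
with `p ∤ m` (Kummer/toric exit `a' = b^p + u ϖ^m`) or `m = p B₀` and `ū ∉ κ^p` (wound exit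
`a' = b^p + (ϖ^{B₀})^p u`). [folklore] -/
theorem stub_boundaryPointNormalForm : ∀ (p : ℕ), p.Prime → ∀ (k : Type) [Field k] [CharP k p]
    (R : Type) [CommRing R] [IsDomain R] [Algebra k R], Algebra.FiniteType k R → IsRegularRing R →
    ringKrullDim R ≤ 1 → ∀ a : R, (∀ b : R, b ^ p ≠ a) →
      ∀ q : PrimeSpectrum R, q.asIdeal ≠ ⊥ →
        ∀ ϖ : Localization.AtPrime q.asIdeal,
          IsLocalRing.maximalIdeal (Localization.AtPrime q.asIdeal) = Ideal.span {ϖ} →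
          GiraudNormalFormAt p ![ϖ] (algebraMap R (Localization.AtPrime q.asIdeal) a) := by
  intro p hp k _ _ R _ _ _ hft hreg hdim a ha q hq ϖ hϖ
  haveI : Fact p.Prime := ⟨hp⟩
  haveI := hft
  haveI := hreg
  haveI : IsIntegrallyClosed R := Negative.isIntegrallyClosed_of_isRegularRing R
  haveI : Ring.DimensionLEOne R := Ring.DimensionLEOne.of_ringKrullDim_le_one hdim
  haveI : IsDedekindRing R := {}
  haveI : IsDiscreteValuationRing (Localization.AtPrime q.asIdeal) :=
    IsLocalization.AtPrime.isDiscreteValuationRing_of_dedekind_domain R hq _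
  haveI : CharP R p := charP_of_injective_algebraMap (algebraMap k R).injective p
  haveI : CharP (Localization.AtPrime q.asIdeal) p :=
    charP_of_injective_algebraMap (IsLocalization.injective (Localization.AtPrime q.asIdeal)
      q.asIdeal.primeCompl_le_nonZeroDivisors) p
  have hϖirr : Irreducible ϖ := (IsDiscreteValuationRing.irreducible_iff_uniformizer ϖ).mpr hϖ
  obtain ⟨b, m, u, hbu, hdich⟩ := DvrDichotomy.exists_sub_pow_eq_mul_unit_dichotomy p hp ϖ hϖirr
    (algebraMap R _ a) (exists_forall_not_pow_dvd p hp k R hdim ha q hq ϖ hϖ)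
  have ha' : algebraMap R (Localization.AtPrime q.asIdeal) a = b ^ p + ϖ ^ m * u := by
    rw [← hbu]; ring
  by_cases hm : p ∣ m
  · -- wound exit
    obtain ⟨B₀, rfl⟩ := hm
    have hw : ∀ c, ¬ ϖ ∣ (u : Localization.AtPrime q.asIdeal) - c ^ p :=
      hdich.resolve_left fun h => h (dvd_mul_right p B₀)
    refine Or.inl ⟨b, u, fun _ => B₀, Or.inl fun c hc => hw c ?_, ?_⟩
    · rwa [hϖ, Ideal.mem_span_singleton] at hc
    · simp only [Fin.prod_univ_one, Matrix.cons_val_fin_one]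
      rw [ha']
      ring
  · -- Kummer/toric exit
    refine Or.inr ⟨b, fun _ => m, u, ⟨0, hm⟩, ?_⟩
    simp only [Fin.prod_univ_one, Matrix.cons_val_fin_one]
    rw [ha']
    ring

end Summit.ResolutionOfSingularities.ResolutionOfSingularities.Theorems.PicoverLocalModel.BoundaryPointNormalForm

end
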